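import Summits.QuantumFields.YangMills.Theorems.BalabanUVNodesN16EntryAWB16RowsOfReg910Slot
import Summits.QuantumFields.YangMills.Theorems.BalabanUVNodesN27SpineGivenEndpointR13SepCoPHVMintedReadingVBFreeBareLedgerReadingN16Produced

/-!
# Route «BalabanUVNodes», crux K3⁸ `SpineGivenEndpointR13SepCoPHV` (stmt-QuantumFields-27366), node N16 = NE3: THE ∃-ELIMINATION ON THE N16 ∕ N27 SEAM — the deepest
# K3⁸ bill of record (dag-n27-w1's MINTED leaf MWBNⱽ p646044) WITH NODE N16 AT ITS PRODUCER (module 54B; the adapter is module 54A `…N16AWB16RowsOfH5Reg910Slot`)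

**EDITION `hE` (generation 24, module 59d; THE TOP KNIT part (b)).**  This file is module 54B (`…N16K3LeafOfH5Reg910Slot`, p648647) with node N05's ℤᵈ
hypothesis REPLACED by node N16's θ-free chain-entry object `hE` (module 57 p688434; served by node N05's Σ-object of record through module 58's `exists_entry_of_n05UniformP F 2 …`,
and by the ℤᵈ road alike), `0 ≤ β` dropped, adapter = module 59c instead of 54A; every other token VERBATIM (generator `HOME/…/lean/g24/gen59/genleaf.py`).

Cell `pub-ymgap`, seat `pub-ymgap-dag-n16-e` (R134 acceleration seat (a), strategy s2 = BY-NAME KNIT at the record; HUMAN RULING D-0062; chair R424 venue), generation 19,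
module 54B (ONE THEOREM, 0 `def`, 0 `sorry`, standard axioms).  `--kind proof --supports stmt-QuantumFields-27366 --as helper` (count-neutral; proves NO registered stub).
`bears_on: R4∕N16 · edges N05 → N16, N07 → N16 · composite N27 (K3⁸ leaf)`.  A terminal, route-facing leaf — nothing should import it; dag-n27-w1's leaf MWBNⱽ is
imported as a LEMMA and consumed BY NAME (body untouched; the gate's `lint.theses-cone` advisory on that import is acknowledged — this file is the top of the cone).

WHAT IS PROVED ([folklore] bookkeeping BY NAME — one `obtain` on module 54A, ONE application of p646044; no estimate).
★★ `spineGivenEndpointR13SepCoPHV_of_entry_reg910Slot_of_restAtProducedLetters` — **K3⁸'s DEEPEST BILL WITH NODE N16 AT ITS PRODUCER** (two-stage, reading-free):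
`hE → slot key → ∃ ℓ₃ g B c' ρ c, ⟨module 54A's rows⟩ ∧ (∀ εTop, hεT → h8P → hU6loc → ∀ K₀ jc sh cr' l₀ Λ b aS ν μ α β' c35 p ℓ s r ksel, hl₀ → hΛ → hb → haS → hs →
hκ → hcr → hκ₀ → hr → hinc → hS → h9 → hWall → hβw → hζm → h20 → h21 → hlinkBareV → h20' → h21' → hx' → hlinkBare' → SpineGivenEndpointR13SepCoPHV)` — MWBNⱽ's
non-N16 binder texts VERBATIM inside the existential (they read the PRODUCED letters `ℓ₃ B ρ`).  After it the deepest K3⁸ bill displays NO N16 row and NO rate reading: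
what is displayed is `hE` (node N16's chain-entry object — node N05's Σ-object through module 58, or the ℤᵈ road), the slot key + (P)-(8) `h8P` + sentence 2 `hU6loc` at any top radius `εTop ≥ ε` (node N07, at the PRODUCED radius `ρ`), node U3's
letter rows, NODE O's bare link-ledger readings, K1's window, ζ-measurability, NE7b ∕ NE7c, the (B)-free scheme rows — all at the produced letters.  The ∃∀ shape is
forced, not chosen: NODE O's and node N07's rows READ node N16's letters, and `hE` + the slot key determine those only existentially.

HONEST FRAMING.  `hE` (node N16's chain-entry object — node N05's Σ-object through module 58, or the ℤᵈ road), the slot key and `h8P` ∕ `hU6loc` (node N07 — [Balaban1985Variational] Thm 1), node U3's ∕ NODE O's ∕ K1's ∕ NE7b–c's rows are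
DISPLAYED hypotheses asserted for no family (K0⁷ `Record13SepCoPHInhabited` OPEN; NODE O's ledger readings UNPRINTED for d = 4, 0 instances); nothing of Bałaban is
asserted or refuted; no stub of K3⁸ v6 (`stub_rates13HV` ∕ `stub_expansion13HV`) is closed or claimed; N16 ∕ N05 ∕ N07 ∕ N27 NOT discharged; K3⁸ OPEN, NOT claimed;
counts UNMOVED (typed 28∕28 · discharged 5∕27 · A 5∕28).  One finite four-torus at fixed `ε`, Bałaban AS PRINTED — NOT ℝ⁴, NOT infinite volume, NOT OS, NOT a mass
gap; the YM mass gap (Clay) is NOT proved by any of this — R4 closes the conditional finite-𝕋⁴ rung `BalabanLadder.UV` only; no summit statement is proved by this seat.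
Reference: [Balaban1985Variational] T. Bałaban, CMP **102** (1985) 277–309, Thm 1 p. 279.
-/

set_option autoImplicit false

namespace Summit.QuantumFields.YangMills.BalabanUVNodes.N16K3LeafOfEntryReg910Slot

open scoped BigOperators Matrix Matrix.Norms.L2Operator
open Finset MeasureTheory
open Literature.MathematicalPhysics.QuantumFieldTheory.Balaban1983to89
open T4OutputRate T4RecentScale T4GoodClassBudget T4CauchySum T4TowerRateComposition T4TowerRateDischarge
open T4EtaRateMin (Readings NE3Shape)
open T4RateLiaison (GaugeDominated)
open FlowStep (RGEqH prefixOf)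
open TreeLengthTorus (TFaceConnected torusTreeLen)
open B12TreeDecay (kappa₀)
open Summit.QuantumFields.BalabanUV.T4Continuum
open AveragingDeficitDualResidual (dualC1 dualC2)
open AveragingDeficitDerivWallProof (wallConst)
open AveragingDeficitPeriodicCounting (IsPeriodicDir)
open MinimalActionSandwich (IsMinimiser minAct)
open MinimalActionRate (sfClass)
open MinimalActionRefine (RegularSup gradConst)
open NE3EnergyShapes (IsUnitarySite IsPeriodicSite)
open NE3.LeafIndexSockets (LeafH3sup)
open Summit.QuantumFields.BalabanUV.T4Continuum.Spine
open Summit.QuantumFields.BalabanUV.T4Continuum.Spine.NE4 (runFlow)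
open Summit.QuantumFields.BalabanUV.T4Continuum.NE1p.DressedRoot (DressedTower DressedStabilityStrict)
open Summit.QuantumFields.YangMills.BalabanUVNodes.N19LedgerLinkSync (LedgerDataSync LedgerAtSync)
open YMDAG.UVSplit
open Summit.QuantumFields.YangMills.BalabanUVNodes.N16HolderDefs (CovRootHolder N16HolderAt)
open Summit.QuantumFields.YangMills.BalabanUVNodes.SpineRatesHolder (RatesHolderAt)
open Literature.MathematicalPhysics.QuantumFieldTheory.Balaban1983to89.T4Continuum (T4Family ULoop)
open Node00 (Stage13HParams datumOfRecord₁₃CoPH SiteSeqKey U3Letters₁₁ NE3Letters₁₁ ne3ConstLayerOfRecord₁₁ ne3NperOfRecord₁₁ ne3DomOfRecord₁₁ ZetaMeasurable ppSelLiveOfRecord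
  EOfRecord₁₃ wOfRecord₉ localBgMeasurable)
open Literature.MathematicalPhysics.QuantumFieldTheory.Balaban1983to89.B12Sec2to5 (betaPrime510)
open Literature.MathematicalPhysics.QuantumFieldTheory.Balaban1983to89.Node00.U3OfKernels (objectsOfRecord₁₃ KernelDecayOfRecord₁₃)
open Literature.MathematicalPhysics.QuantumFieldTheory.Balaban1983to89.Node00.U3KernelLetters (GeometricIncrementsOfRecord₁₃ WindowedNE9OfRecord₁₃ WindowedDecayOfRecord₁₃
  WindowedStepRateOfRecord₁₃)
open Summit.QuantumFields.YangMills.BalabanUVNodes.N16PinnedLayer13CoPH (N16PinnedLoose N16LettersEnd N16HolderAtReading rateCarriers_ne3_of_pinnedLoose n16HolderAtReading_iff_of_pinnedLoose)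
open Summit.QuantumFields.YangMills.BalabanUVNodes.N19TargetClassWeightsE1Keyed
open YMDAG.N14.TopBorn (ne1OfRecord Ne1PinnedOfRecord n14At_rateCarriersOfRecord₁₃CoPH_of_pinned)
open Summit.QuantumFields.YangMills.BalabanUVNodes.N15.GenuineRecord (fullGSizedObjects n15At_fullGSizedObjects_family)
open Summit.QuantumFields.YangMills.BalabanUVNodes.N15.AtKeyedHome (neZero_blockFactor)
open YMDAG.N18.PolLimitRate (u3KernelInputs_of_finiteVolumeLetters)
open T4WeightBudget T4IndicatorShell T4ContinuumYM4Torus T4ApexHybrid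
open Summit.QuantumFields.YangMills.Theses.BalabanUVNodes (SpineGivenEndpointR13SepCoPHV)
open Summit.QuantumFields.YangMills.Theorems.BalabanUVNodesN27SpineRecord
  (spineGivenEndpointR13SepCoPHV_of_liveMintedV5PinsAtCrOfRecord₁₃VAt_cut_bareLedgerReadingV_n16Produced_offLive_mintedV5Pins_bareLedgerReading_n16Produced)
open Summit.QuantumFields.YangMills.BalabanUVNodes.N16EntryAWB16RowsOfReg910Slot (exists_letters_awb16Rows_of_entry_reg910Slot)

noncomputable section
variable {β : ℝ}

open B7Eq92Concrete (mgauge) in open B8Ineq132 (covDerivFwd) in open B8Eq184Proof (cfgExp) in open B8Eq119TwistedAxial (Restr129) in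
open B8Eq138LandauZd (covLap IsLandau138) in open B8Thm4TorusAt (torusLam Thm4TorusAt) in
/-- **★★ K3⁸'s DEEPEST BILL WITH NODE N16 AT ITS PRODUCER** (two-stage, reading-free).  From `hE` (node N05) and the slot key (node N07): letters `ℓ₃ g B c' ρ c` carrying
§1's rows, such that — for every top radius `εTop ≥ ε` with node N07's two sentences `h8P` ((P)-(8) at `(ρ F, εTop F)`) and `hU6loc` (Thm 1 sentence 2 for interior local
minimisers at `εTop F`), and every choice of the other letters `K₀ jc sh cr' l₀ Λ b aS ν μ α β' c35 p ℓ s r ksel` with dag-n27-w1's MWBNⱽ binder texts `hl₀ … hlinkBare'`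
VERBATIM (node U3's letter rows, K1's window, ζ-measurability, NE7b ∕ NE7c live and off-live, NODE O's bare link-ledger readings live and off-live, the (B)-free scheme rows;
they read the produced `ℓ₃ B`) — THE ITEM `SpineGivenEndpointR13SepCoPHV` holds.  One `obtain` on §1, ONE application of p646044.  NOT a discharge: every displayed row is
a HYPOTHESIS inhabited for no family today; no stub closed; K3⁸ OPEN. [bookkeeping] [folklore] -/
theorem spineGivenEndpointR13SepCoPHV_of_entry_reg910Slot_of_restAtProducedLetters (hβ23 : 2 / 3 < β) (hβ1 : β ≤ 1)
    (hE : ∀ F : T4Family, ∃ B Bh c₁' : ℝ, 0 < B ∧ 0 < c₁' ∧ 16 * (B * c₁') ≤ 1 ∧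
      ∀ k, 1 ≤ k → Thm4TorusAt F.L k (((ne3NperOfRecord₁₁ F 0 0 * F.L ^ k : ℕ) : ℤ)) (((F.L : ℝ) ^ k)⁻¹) c₁' (B7Prop2Explicit.unitaryUnits (Matrix (Fin 2) (Fin 2) ℂ))
        (fun _ => True) (Restr129 F.L k (torusLam k))
        (fun (α₀ α₁ : ℝ) (U₀ U' : B7Prop1Explicit.Site 4 → Fin 4 → (Matrix (Fin 2) (Fin 2) ℂ)ˣ) (u : B7Prop1Explicit.Site 4 → (Matrix (Fin 2) (Fin 2) ℂ)ˣ) =>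
          ∃ A : B7Prop1Explicit.Site 4 → Fin 4 → Matrix (Fin 2) (Fin 2) ℂ,
            (∀ x μ, IsSelfAdjoint (A x μ)) ∧
            (∀ (x : B7Prop1Explicit.Site 4) (κ μ : Fin 4), A (x + (((ne3NperOfRecord₁₁ F 0 0 * F.L ^ k : ℕ) : ℤ)) • B7Prop1Explicit.e κ) μ = A x μ) ∧
            mgauge U₀ u (cfgExp (((F.L : ℝ) ^ k)⁻¹) A) = U' ∧
            (∀ x μ, ‖A x μ‖ ≤ B * (α₀ + α₁)) ∧
            (∀ (μ : Fin 4) (x : B7Prop1Explicit.Site 4) (κ : Fin 4), ‖covDerivFwd (((F.L : ℝ) ^ k)⁻¹) U₀ μ (fun z => A z κ) x‖ ≤ B * (α₀ + α₁)) ∧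
            IsLandau138 F.L k (((F.L : ℝ) ^ k)⁻¹) Set.univ (torusLam k) U₀ A ∧
            (∀ (μ : Fin 4) (y : B7Prop1Explicit.Site 4) (κ : Fin 4),
              ‖T4AveragingDeficitWall.Ad (U₀ y μ) (covDerivFwd (((F.L : ℝ) ^ k)⁻¹) U₀ μ (fun z => A z κ) (y + B7Prop1Explicit.e μ)) -
                  covDerivFwd (((F.L : ℝ) ^ k)⁻¹) U₀ μ (fun z => A z κ) y‖ ≤ Bh * (α₀ + α₁) * (((F.L : ℝ)⁻¹) ^ k) ^ β) ∧
            (∀ (x : B7Prop1Explicit.Site 4) (κ : Fin 4), ‖covLap (((F.L : ℝ) ^ k)⁻¹) U₀ (fun z => A z κ) x‖ ≤ B * (α₀ + α₁))))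
    {G : T4Family → (B7Prop1Explicit.Site 4 → Fin 4 → (Node00.MatA 2)ˣ) → B7Prop1Explicit.Site 4 → ℕ → ℝ → ℝ → ℝ → Prop}
    (hGm : ∀ F, MinimalActionDictionary.RadiiMono 4 (G F))
    (hG : ∀ (F : T4Family) (U : B7Prop1Explicit.Site 4 → Fin 4 → (Node00.MatA 2)ˣ) (x : B7Prop1Explicit.Site 4) (K : ℕ) (α₀ α₁ α₂ : ℝ), 2 ≤ K → G F U x K α₀ α₁ α₂ →
      ∃ (u : B7Prop1Explicit.Site 4 → (Node00.MatA 2)ˣ) (a : B7Prop1Explicit.Site 4 → Fin 4 → Node00.MatA 2),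
        (∀ z, u z ∈ B7Prop2Explicit.unitaryUnits (Node00.MatA 2)) ∧
        (∀ (y : B7Prop1Explicit.Site 4) (τ : Fin 4), B7Prop1Explicit.l1 (y - x) ≤ 2 →
          ((B7Prop1Explicit.gaugeAct u U y τ : (Node00.MatA 2)ˣ) : Node00.MatA 2) = NormedSpace.exp (a y τ)) ∧
        (∀ (y : B7Prop1Explicit.Site 4) (τ : Fin 4), B7Prop1Explicit.l1 (y - x) ≤ 2 → ‖a y τ‖ ≤ α₀) ∧
        (∀ (y : B7Prop1Explicit.Site 4) (τ i : Fin 4), B7Prop1Explicit.l1 (y - x) ≤ 1 → ‖AveragingDeficitLatticeH2Prep.fd i (fun z => a z τ) y‖ ≤ α₁) ∧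
        (∀ (τ i l : Fin 4), ‖AveragingDeficitLatticeH2Prep.fd i (AveragingDeficitLatticeH2Prep.fd l (fun z => a z τ)) x‖ ≤ α₂))
    (C : T4Family → B11Thm1.Consts)
    (hR : ∀ (F : T4Family) (k : ℕ) (ε₁ : ℝ), 0 < ε₁ → ε₁ ≤ (C F).a₁ → ∀ (V U : B7Prop1Explicit.Site 4 → Fin 4 → (Node00.MatA 2)ˣ),
      V ∈ sfClass 4 F.L (ne3NperOfRecord₁₁ F 0 0) ε₁ 0 →
      IsMinimiser 4 (sfClass 4 F.L (ne3NperOfRecord₁₁ F 0 0) ((C F).B₃ * ε₁)) F.L (ne3NperOfRecord₁₁ F 0 0) (k + 1) V U →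
        ∀ x : B7Prop1Explicit.Site 4, B11.Regularity (MinimalActionDictionary.torusVP 4 F.L (ne3NperOfRecord₁₁ F 0 0) (G F) (k + 1)) (C F).B₃ (C F).B₄ ε₁ U
          (x, F.L ^ (k + 1) - 1 + F.L ^ (k + 1) + 2)) :
    ∃ (ℓ₃ : T4Family → NE3Letters₁₁) (g B c' ρ c : T4Family → ℝ),
      (N16LettersEnd 2 g ℓ₃ ∧
      (∀ F : T4Family, 0 < B F ∧ (ℓ₃ F).ε / B F ≤ (ℓ₃ F).b) ∧
      (∀ F : T4Family, (C F).B₃ ≤ B F ∧ (2 : ℝ) ^ 78 * (F.L : ℝ) ^ 12 ≤ B F) ∧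
      (∀ F : T4Family, (ℓ₃ F).g = gradConst 4 (c' F) ∧ 0 ≤ c' F ∧ 0 < c' F ∧ (ℓ₃ F).b ≤ c' F ∧
          (2 : ℝ) ^ 91 * (F.L : ℝ) ^ 17 * c' F ≤ 1 ∧ (2 : ℝ) ^ 76 * (F.L : ℝ) ^ 12 * c' F ≤ (ℓ₃ F).ε ∧ (ℓ₃ F).ε / B F ≤ 1 / 4 ∧ 4 * ((ℓ₃ F).ε / B F) ≤ c' F) ∧
      (∀ F : T4Family, 16 * B7Prop2Explicit.C0 4 * (ℓ₃ F).ε ≤ 3 ∧ 1024 * (4 + 1) * (4 + 4) * (F.L : ℝ) ^ 2 * (ℓ₃ F).ε ≤ 1) ∧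
      (∀ (F : T4Family), (∃ θ : Stage13HParams F 2, θ.Provisos₁₃CoPH F 2 ∧ (θ.ZhUnity F 2 ∧ θ.SlotsNondegenerate₁₃ F 2) ∧ θ.Admissible F 2) →
          N16HolderAt (ne3OfRecord₁₁ F { ne3ConstLayerOfRecord₁₁ F 2 (ℓ₃ F) with
            dom := {V | V ∈ ne3DomOfRecord₁₁ F 2 0 0 ∧ V ∈ sfClass 4 F.L (ne3NperOfRecord₁₁ F 0 0) ((ℓ₃ F).ε / B F) 0} }) β) ∧
      (∀ F : T4Family, LeafH3sup 4 F.L (ne3NperOfRecord₁₁ F 0 0) (ρ F) (ρ F) (c F)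
          ({V | V ∈ ne3DomOfRecord₁₁ F 2 0 0 ∧ V ∈ sfClass 4 F.L (ne3NperOfRecord₁₁ F 0 0) ((ℓ₃ F).ε / B F) 0} : Set (B7Prop1Explicit.Site 4 → Fin 4 → (Node00.MatA 2)ˣ))) ∧
      (∀ F : T4Family, ρ F ≤ (ℓ₃ F).ε) ∧
      (∀ F : T4Family, ρ F ≤ (ℓ₃ F).b) ∧
      (∀ F : T4Family, c F ≤ c' F) ∧
      (∀ F : T4Family, g F = gradConst 4 (c' F) ∧ ρ F = (C F).B₃ * ((ℓ₃ F).ε / B F) ∧ c F = 16937 * ρ F ∧ 0 < ρ F ∧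
        ρ F ≤ (C F).B₃ * (C F).a₁ ∧ ρ F ≤ 1 / 28)) ∧
      (∀ εTop : T4Family → ℝ, (∀ F : T4Family, (ℓ₃ F).ε ≤ εTop F) →
        (∀ (F : T4Family), ∀ V ∈ ({V | V ∈ ne3DomOfRecord₁₁ F 2 0 0 ∧ V ∈ sfClass 4 F.L (ne3NperOfRecord₁₁ F 0 0) ((ℓ₃ F).ε / B F) 0} :
              Set (B7Prop1Explicit.Site 4 → Fin 4 → (Node00.MatA 2)ˣ)), ∀ k : ℕ, ∃ U₀ : B7Prop1Explicit.Site 4 → Fin 4 → (Node00.MatA 2)ˣ,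
            U₀ ∈ sfClass 4 F.L (ne3NperOfRecord₁₁ F 0 0) (ρ F) (k + 1) ∧
              IsMinimiser 4 (sfClass 4 F.L (ne3NperOfRecord₁₁ F 0 0) (εTop F)) F.L (ne3NperOfRecord₁₁ F 0 0) (k + 1) V U₀) →
        (∀ (F : T4Family) (k : ℕ), ∀ V ∈ ({V | V ∈ ne3DomOfRecord₁₁ F 2 0 0 ∧ V ∈ sfClass 4 F.L (ne3NperOfRecord₁₁ F 0 0) ((ℓ₃ F).ε / B F) 0} :
              Set (B7Prop1Explicit.Site 4 → Fin 4 → (Node00.MatA 2)ˣ)),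
            ∀ U₀ : B7Prop1Explicit.Site 4 → Fin 4 → (Node00.MatA 2)ˣ, IsMinimiser 4 (sfClass 4 F.L (ne3NperOfRecord₁₁ F 0 0) (ρ F)) F.L (ne3NperOfRecord₁₁ F 0 0) (k + 1) V U₀ →
            ∀ U : B7Prop1Explicit.Site 4 → Fin 4 → (Node00.MatA 2)ˣ, U ∈ sfClass 4 F.L (ne3NperOfRecord₁₁ F 0 0) (εTop F) (k + 1) → B7Prop2Explicit.avgIter F.L U (k + 1) = V →
              U ∈ sfClass 4 F.L (ne3NperOfRecord₁₁ F 0 0) (ℓ₃ F).ε (k + 1) →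
              IsLocalMinOn (fun W : B7Prop1Explicit.Site 4 → Fin 4 → (Node00.MatA 2)ˣ => MinimalActionLevels.levelAction 4 F.L (ne3NperOfRecord₁₁ F 0 0) (k + 1) W)
                (MinimalActionSandwich.admissible (sfClass 4 F.L (ne3NperOfRecord₁₁ F 0 0) (εTop F)) F.L (k + 1) V) U →
              ∃ u : B7Prop1Explicit.Site 4 → (Node00.MatA 2)ˣ, IsUnitarySite u ∧ IsPeriodicSite u ((ne3NperOfRecord₁₁ F 0 0 * F.L ^ (k + 1) : ℕ) : ℤ) ∧ B7Prop1Explicit.gaugeAct u U₀ = U) →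
        ∀ (K₀ : ℕ) (jc : (F : T4Family) → (θ : Stage13HParams F 2) → θ.Provisos₁₃CoPH F 2 → (ℕ → ℝ) → List (ULoop F) → ℕ → ℕ)
          (sh : ShellSplit₁₃CoPH 2 K₀) (cr' : (F : T4Family) → (θ : Stage13HParams F 2) → θ.Provisos₁₃CoPH F 2 → (ℕ → ℝ) → List (ULoop F) → SpineCarriers)
          (l₀ Λ b aS : ℝ) (ν μ α β' : Fin 4) (c35 p : ℝ)
          (ℓ : (F : T4Family) → Stage13HParams F 2 → U3Letters₁₁) (s : (F : T4Family) → Stage13HParams F 2 → ℕ) (r : (F : T4Family) → Stage13HParams F 2 → ℝ)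
          (ksel : (F : T4Family) → (θ : Stage13HParams F 2) → θ.Provisos₁₃CoPH F 2 → (ℕ → ℝ) → List (ULoop F) → ℕ)
          (hl₀ : 0 < l₀) (hΛ : 0 ≤ Λ) (hb : 0 < b) (haS : 0 < aS)
          (hs : ∀ (F : T4Family) (θ : Stage13HParams F 2), θ.Provisos₁₃CoPH F 2 → (θ.ZhUnity F 2 ∧ θ.SlotsNondegenerate₁₃ F 2) → θ.Admissible F 2 → (ℓ F θ).Signs)
          (hκ : ∀ (F : T4Family) (θ : Stage13HParams F 2), θ.Provisos₁₃CoPH F 2 → (θ.ZhUnity F 2 ∧ θ.SlotsNondegenerate₁₃ F 2) → θ.Admissible F 2 → 0 < (ℓ F θ).κ)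
          (hcr : ∀ (F : T4Family) (θ : Stage13HParams F 2), θ.Provisos₁₃CoPH F 2 → (θ.ZhUnity F 2 ∧ θ.SlotsNondegenerate₁₃ F 2) → θ.Admissible F 2 →
            betaPrime510 4 1 (ℓ F θ).κ ≤ (ℓ F θ).cr)
          (hκ₀ : ∀ (F : T4Family) (θ : Stage13HParams F 2), θ.Provisos₁₃CoPH F 2 → (θ.ZhUnity F 2 ∧ θ.SlotsNondegenerate₁₃ F 2) → θ.Admissible F 2 → kappa₀ (4 * 2 ^ 4) (2 * 4) ≤ (ℓ F θ).κ)
          (hr : ∀ (F : T4Family) (θ : Stage13HParams F 2), θ.Provisos₁₃CoPH F 2 → (θ.ZhUnity F 2 ∧ θ.SlotsNondegenerate₁₃ F 2) → θ.Admissible F 2 → r F θ < 1)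
          (hinc : ∀ (F : T4Family) (θ : Stage13HParams F 2), θ.Provisos₁₃CoPH F 2 → (θ.ZhUnity F 2 ∧ θ.SlotsNondegenerate₁₃ F 2) → θ.Admissible F 2 →
            GeometricIncrementsOfRecord₁₃ F 2 θ.toStage13Params (r F θ))
          (hS : ∀ (F : T4Family) (θ : Stage13HParams F 2), θ.Provisos₁₃CoPH F 2 → (θ.ZhUnity F 2 ∧ θ.SlotsNondegenerate₁₃ F 2) → θ.Admissible F 2 →
            WindowedStepRateOfRecord₁₃ F 2 θ.toStage13Params (s F θ) (ℓ F θ).κ (ℓ F θ).θ₅ ((ℓ F θ).C₅ * (ℓ F θ).θ₅))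
          (h9 : ∀ (F : T4Family) (θ : Stage13HParams F 2), θ.Provisos₁₃CoPH F 2 → (θ.ZhUnity F 2 ∧ θ.SlotsNondegenerate₁₃ F 2) → θ.Admissible F 2 →
            WindowedNE9OfRecord₁₃ F 2 θ.toStage13Params (ℓ F θ).κ (ℓ F θ).moduli)
          (hWall : ∀ (μ ν : Fin 4) (F : T4Family) (θ : Stage13HParams F 2), θ.Provisos₁₃CoPH F 2 → (θ.ZhUnity F 2 ∧ θ.SlotsNondegenerate₁₃ F 2) → θ.Admissible F 2 →
            WindowedDecayOfRecord₁₃ F 2 θ.toStage13Params μ ν (ℓ F θ).κ)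
          (hβw : ∀ (F : T4Family) (θ : Stage13HParams F 2) (hP : θ.Provisos₁₃CoPH F 2), (θ.ZhUnity F 2 ∧ θ.SlotsNondegenerate₁₃ F 2) → θ.Admissible F 2 →
            ∃ γ₀ b b' : ℝ, 0 < γ₀ ∧ 0 < b ∧ DagBinding.BetaBoundsInInterval (datumOfRecord₁₃CoPH F 2 θ hP).C.toB12 γ₀ b b')
          (hζm : ∀ (F : T4Family) (θ : Stage13HParams F 2), θ.Provisos₁₃CoPH F 2 → ((θ.ZhUnity F 2 ∧ θ.SlotsNondegenerate₁₃ F 2) ∧ θ.ppSel = ppSelLiveOfRecord F 2 θ.ν θ.τ9 (EOfRecord₁₃ F 2 θ.toStage13Params) (wOfRecord₉ F 2 θ.toStage9Params)) → θ.Admissible F 2 →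
            ZetaMeasurable F 2 θ.ζ)
          (h20 : ∀ (F : T4Family) (θ : Stage13HParams F 2) (hP : θ.Provisos₁₃CoPH F 2), ((θ.ZhUnity F 2 ∧ θ.SlotsNondegenerate₁₃ F 2) ∧ θ.ppSel = ppSelLiveOfRecord F 2 θ.ν θ.τ9 (EOfRecord₁₃ F 2 θ.toStage13Params) (wOfRecord₉ F 2 θ.toStage9Params)) → θ.Admissible F 2 →
            ∀ (g₀ : ℕ → ℝ) (os : List (ULoop F)),
              ∃ W : ℕ → ℝ, RelWeightBound 1 (classSet₁₃ θ K₀ g₀) (weightA₁₃ θ hP K₀ g₀ os) (weightB₁₃ θ hP K₀ g₀ os) (badClass₁₃ θ K₀ g₀ (jc F θ hP g₀ os)) W)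
          (h21 : ∀ (F : T4Family) (θ : Stage13HParams F 2) (hP : θ.Provisos₁₃CoPH F 2), ((θ.ZhUnity F 2 ∧ θ.SlotsNondegenerate₁₃ F 2) ∧ θ.ppSel = ppSelLiveOfRecord F 2 θ.ν θ.τ9 (EOfRecord₁₃ F 2 θ.toStage13Params) (wOfRecord₉ F 2 θ.toStage9Params)) → θ.Admissible F 2 →
            ∀ (g₀ : ℕ → ℝ) (os : List (ULoop F)),
              ∃ Wsh : ℕ → ℝ, ShellWeightBound 1 (classSet₁₃ θ K₀ g₀) (weightA₁₃ θ hP K₀ g₀ os) (weightB₁₃ θ hP K₀ g₀ os) (sh F θ hP g₀ os).1 (sh F θ hP g₀ os).2 Wsh)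
          (hlinkBareV : ∀ (F : T4Family) (θ : Stage13HParams F 2) (hP : θ.Provisos₁₃CoPH F 2), ((θ.ZhUnity F 2 ∧ θ.SlotsNondegenerate₁₃ F 2) ∧ θ.ppSel = ppSelLiveOfRecord F 2 θ.ν θ.τ9 (EOfRecord₁₃ F 2 θ.toStage13Params) (wOfRecord₉ F 2 θ.toStage9Params)) → θ.Admissible F 2 →
            ∀ (γ gIR b : ℝ) (g₀ : ℕ → ℝ), (datumOfRecord₁₃CoPH F 2 θ hP).Tuned γ gIR g₀ → γ ≤ θ.γ → γ ^ 2 ≤ Real.exp (-1) → 0 < b →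
            (∀ K m, 0 ≤ m → m < K → b ≤ (datumOfRecord₁₃CoPH F 2 θ hP).βfun m (prefixOf (runFlow (datumOfRecord₁₃CoPH F 2 θ hP) g₀ K) m)) →
            ∀ (os : List (ULoop F)) (k : ℕ),
            let S : SpineCarriers := crOfRecord₁₃VAt K₀ (jc F θ hP g₀ os) sh F θ hP g₀ os
            let R : RateCarriers 2 :=
              ⟨ne1OfRecord l₀ Λ F θ hP g₀ os, ne2OfRecord₁₁ (haveI := neZero_blockFactor F; fullGSizedObjects 3 F.hL b aS ν μ α β' c35 p),
                ne3OfRecord₁₁ F { ne3ConstLayerOfRecord₁₁ F 2 (ℓ₃ F) with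
                  dom := {V | V ∈ ne3DomOfRecord₁₁ F 2 0 0 ∧ V ∈ sfClass 4 F.L (ne3NperOfRecord₁₁ F 0 0) ((ℓ₃ F).ε / B F) 0} },
                u3OfRecord₁₃ θ.toStage13Params (objectsOfRecord₁₃ F 2 θ.toStage13Params (ℓ F θ)) k⟩
            let D : Datum F 2 := datumOfRecord₁₃CoPH F 2 θ hP
            letI := S.dec
            ∃ (_ : DecidableEq R.u3.C.Dom) (F' : Type) (ι' X' : Type) (_ : MeasurableSpace ι')
              (L : LedgerDataSync R.u3.C F' ι' S.ι) (Rd : Readings ι' X') (bsel : (ℕ → ℝ) → ℝ) (EB : Functional R.u3.C R.u3.C.BgB)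
              (g : ℕ → ℕ → ℝ)
              (uA : ℕ → ι' → R.u3.C.BgA) (uB : ℕ → ι' → R.u3.C.BgB)
              (Koff : ℕ) (cells : (K j : ℕ) → R.u3.C.Dom → Finset (Site (F.P (Koff + K)) j))
              (θ : ℝ)
              (rd : ι' → (B7Prop1Explicit.Site 4 → Fin 4 → (Matrix (Fin 2) (Fin 2) ℂ)ˣ)),
              (∀ K i, i ≤ K → g K i = runFlow D g₀ K i) ∧ (∀ K i, K < i → g K i = gIR) ∧
              EB = (fun s => R.u3.EB (bsel s) s) ∧
              (∀ (Sz : ℕ → ℝ → S.ι → ℕ → ℝ) (E₀ : ℝ) (m : ℕ) (a : ℝ) (Cw Λg : ℝ),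
                (∀ K t, |t| ≤ S.l₀ → ∀ τ ∈ S.T K \ S.Bad K t, ∀ v ∈ Rd.dom, ∀ j ≤ K,
                  |∑ X ∈ L.fac K t τ with R.u3.C.scale X = j,
                      (Real.log (Real.exp (EB (fun i => g (K + 1) (i + 1)) (uB K v) X
                          - EB (fun i => g (K + 1) (i + 1)) L.oneB X))
                        - Real.log (Real.exp (R.u3.EA (g K) (uA K v) X - R.u3.EA (g K) L.oneA X)))| ≤ Sz K t τ j) →
                0 ≤ E₀ → 0 < a → a < 1 →
                (∀ K t, |t| ≤ S.l₀ → ∀ τ ∈ S.T K \ S.Bad K t, ∀ j ≤ K,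
                  Sz K t τ j ≤ S.vol * (E₀ * ((K : ℝ) + 1) ^ m * a ^ (K - j))) →
                (∀ K, Multiplicity (L.All K) R.u3.C.scale (fun X => Real.exp (-(R.u3.κ * R.u3.C.d X))) Cw S.vol Λg K) →
                (∀ K t, |t| ≤ S.l₀ → ∀ τ ∈ S.T K \ S.Bad K t,
                  WindowMultiplicity (L.facO K t τ) L.scO L.wO Cw S.vol Λg (jlogOf L.Cl K) K) →
                1 ≤ Λg → L.θ' ≤ Λg →
                LedgerAtSync { L with S := Sz, E₀ := E₀, m := m, a := a, Cw := Cw, Λg := Λg } S.l₀ S.vol S.T S.Bad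
                  (fun K t τ => S.A K t τ - S.shA K t τ) (fun K t τ => S.B K t τ - S.shB K t τ) Rd R.u3.EA EB R.u3.κ g uA uB
                  R.u3.ω R.u3.ρ R.u3.θ (θ ^ ((3 : ℝ) * β - 2))) ∧
              (∀ K t, |t| ≤ S.l₀ → ∀ τ ∈ S.T K \ S.Bad K t,
                WindowMultiplicity (L.facO K t τ) L.scO L.wO L.Cw S.vol L.Λg (jlogOf L.Cl K) K) ∧
              0 ≤ L.Cw ∧ 1 ≤ L.Λg ∧ L.θ' ≤ L.Λg ∧
              (∀ K, ∀ X ∈ L.All K,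
                (cells K (R.u3.C.scale X + Koff) X).Nonempty ∧ TFaceConnected (cells K (R.u3.C.scale X + Koff) X)) ∧
              (∀ K j, Set.InjOn (cells K j) ↑((L.All K).filter fun X => R.u3.C.scale X + Koff = j)) ∧
              (∀ K, ∀ X ∈ L.All K, torusTreeLen (cells K (R.u3.C.scale X + Koff) X) ≤ R.u3.C.d X) ∧
              0 < θ ∧ θ ^ 6 = ((R.ne3.L : ℝ))⁻¹ ∧
              (∀ v ∈ Rd.dom, rd v ∈ R.ne3.dom) ∧
              (∀ k, ∀ v ∈ Rd.dom, Rd.act k v = minAct 4 (sfClass 4 R.ne3.L R.ne3.Nper R.ne3.ε) R.ne3.L R.ne3.Nper k (rd v)) ∧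
              (R.ne3.Nper : ℝ) ^ 4 ≤ Rd.vol ∧
              (∀ s ∈ Window γ, 0 < bsel s ∧ bsel s ≤ γ))
          (h20' : ∀ (F : T4Family) (θ : Stage13HParams F 2) (hP : θ.Provisos₁₃CoPH F 2), ((θ.ZhUnity F 2 ∧ θ.SlotsNondegenerate₁₃ F 2) ∧ ¬ θ.ppSel = ppSelLiveOfRecord F 2 θ.ν θ.τ9 (EOfRecord₁₃ F 2 θ.toStage13Params) (wOfRecord₉ F 2 θ.toStage9Params)) → θ.Admissible F 2 →
            ∀ (g₀ : ℕ → ℝ) (os : List (ULoop F)),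
              RelWeightBound (cr' F θ hP g₀ os).l₀ (cr' F θ hP g₀ os).T (cr' F θ hP g₀ os).A (cr' F θ hP g₀ os).B (cr' F θ hP g₀ os).Bad (cr' F θ hP g₀ os).W)
          (h21' : ∀ (F : T4Family) (θ : Stage13HParams F 2) (hP : θ.Provisos₁₃CoPH F 2), ((θ.ZhUnity F 2 ∧ θ.SlotsNondegenerate₁₃ F 2) ∧ ¬ θ.ppSel = ppSelLiveOfRecord F 2 θ.ν θ.τ9 (EOfRecord₁₃ F 2 θ.toStage13Params) (wOfRecord₉ F 2 θ.toStage9Params)) → θ.Admissible F 2 →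
            ∀ (g₀ : ℕ → ℝ) (os : List (ULoop F)),
              ShellWeightBound (cr' F θ hP g₀ os).l₀ (cr' F θ hP g₀ os).T (cr' F θ hP g₀ os).A (cr' F θ hP g₀ os).B (cr' F θ hP g₀ os).shA (cr' F θ hP g₀ os).shB
                (cr' F θ hP g₀ os).Wsh)
          (hx' : ∀ (F : T4Family) (θ : Stage13HParams F 2) (hP : θ.Provisos₁₃CoPH F 2), ((θ.ZhUnity F 2 ∧ θ.SlotsNondegenerate₁₃ F 2) ∧ ¬ θ.ppSel = ppSelLiveOfRecord F 2 θ.ν θ.τ9 (EOfRecord₁₃ F 2 θ.toStage13Params) (wOfRecord₉ F 2 θ.toStage9Params)) → θ.Admissible F 2 →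
              ForSmallCouplings (datumOfRecord₁₃CoPH F 2 θ hP) fun g₀ => ∀ os : List (ULoop F),
                0 < (cr' F θ hP g₀ os).l₀ ∧ 0 < (cr' F θ hP g₀ os).vol ∧
                (∀ (K : ℕ) (t : ℝ), |t| ≤ (cr' F θ hP g₀ os).l₀ →
                  T4GenFunBounds.schemeZ ((datumOfRecord₁₃CoPH F 2 θ hP).scheme g₀) os ((cr' F θ hP g₀ os).K₀ + K) t =
                    ∑ τ ∈ (cr' F θ hP g₀ os).T K, (cr' F θ hP g₀ os).A K t τ) ∧
                (∀ (K : ℕ) (t : ℝ), |t| ≤ (cr' F θ hP g₀ os).l₀ →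
                  T4GenFunBounds.schemeZ ((datumOfRecord₁₃CoPH F 2 θ hP).scheme g₀) os ((cr' F θ hP g₀ os).K₀ + K + 1) t =
                    ∑ τ ∈ (cr' F θ hP g₀ os).T K, (cr' F θ hP g₀ os).B K t τ))
          (hlinkBare' : ∀ (F : T4Family) (θ : Stage13HParams F 2) (hP : θ.Provisos₁₃CoPH F 2), ((θ.ZhUnity F 2 ∧ θ.SlotsNondegenerate₁₃ F 2) ∧ ¬ θ.ppSel = ppSelLiveOfRecord F 2 θ.ν θ.τ9 (EOfRecord₁₃ F 2 θ.toStage13Params) (wOfRecord₉ F 2 θ.toStage9Params)) → θ.Admissible F 2 →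
            ∀ (γ gIR b : ℝ) (g₀ : ℕ → ℝ), (datumOfRecord₁₃CoPH F 2 θ hP).Tuned γ gIR g₀ → γ ≤ θ.γ → γ ^ 2 ≤ Real.exp (-1) → 0 < b →
            (∀ K m, 0 ≤ m → m < K → b ≤ (datumOfRecord₁₃CoPH F 2 θ hP).βfun m (prefixOf (runFlow (datumOfRecord₁₃CoPH F 2 θ hP) g₀ K) m)) →
            ∀ (os : List (ULoop F)) (k : ℕ),
            let S : SpineCarriers := cr' F θ hP g₀ os
            let R : RateCarriers 2 :=
              ⟨ne1OfRecord l₀ Λ F θ hP g₀ os, ne2OfRecord₁₁ (haveI := neZero_blockFactor F; fullGSizedObjects 3 F.hL b aS ν μ α β' c35 p),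
                ne3OfRecord₁₁ F { ne3ConstLayerOfRecord₁₁ F 2 (ℓ₃ F) with
                  dom := {V | V ∈ ne3DomOfRecord₁₁ F 2 0 0 ∧ V ∈ sfClass 4 F.L (ne3NperOfRecord₁₁ F 0 0) ((ℓ₃ F).ε / B F) 0} },
                u3OfRecord₁₃ θ.toStage13Params (objectsOfRecord₁₃ F 2 θ.toStage13Params (ℓ F θ)) k⟩
            let D : Datum F 2 := datumOfRecord₁₃CoPH F 2 θ hP
            letI := S.dec
            ∃ (_ : DecidableEq R.u3.C.Dom) (F' : Type) (ι' X' : Type) (_ : MeasurableSpace ι')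
              (L : LedgerDataSync R.u3.C F' ι' S.ι) (Rd : Readings ι' X') (bsel : (ℕ → ℝ) → ℝ) (EB : Functional R.u3.C R.u3.C.BgB)
              (g : ℕ → ℕ → ℝ)
              (uA : ℕ → ι' → R.u3.C.BgA) (uB : ℕ → ι' → R.u3.C.BgB)
              (Pf : ℕ → Params) (d₀ L₀ Koff : ℕ) (cells : (K j : ℕ) → R.u3.C.Dom → Finset (Site (Pf K) j))
              (θ : ℝ)
              (rd : ι' → (B7Prop1Explicit.Site 4 → Fin 4 → (Matrix (Fin 2) (Fin 2) ℂ)ˣ)),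
              (∀ K i, i ≤ K → g K i = runFlow D g₀ K i) ∧ (∀ K i, K < i → g K i = gIR) ∧
              EB = (fun s => R.u3.EB (bsel s) s) ∧
              (∀ (Sz : ℕ → ℝ → S.ι → ℕ → ℝ) (E₀ : ℝ) (m : ℕ) (a : ℝ) (Cw Λg : ℝ),
                (∀ K t, |t| ≤ S.l₀ → ∀ τ ∈ S.T K \ S.Bad K t, ∀ v ∈ Rd.dom, ∀ j ≤ K,
                  |∑ X ∈ L.fac K t τ with R.u3.C.scale X = j,
                      (Real.log (Real.exp (EB (fun i => g (K + 1) (i + 1)) (uB K v) X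
                          - EB (fun i => g (K + 1) (i + 1)) L.oneB X))
                        - Real.log (Real.exp (R.u3.EA (g K) (uA K v) X - R.u3.EA (g K) L.oneA X)))| ≤ Sz K t τ j) →
                0 ≤ E₀ → 0 < a → a < 1 →
                (∀ K t, |t| ≤ S.l₀ → ∀ τ ∈ S.T K \ S.Bad K t, ∀ j ≤ K,
                  Sz K t τ j ≤ S.vol * (E₀ * ((K : ℝ) + 1) ^ m * a ^ (K - j))) →
                (∀ K, Multiplicity (L.All K) R.u3.C.scale (fun X => Real.exp (-(R.u3.κ * R.u3.C.d X))) Cw S.vol Λg K) →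
                (∀ K t, |t| ≤ S.l₀ → ∀ τ ∈ S.T K \ S.Bad K t,
                  WindowMultiplicity (L.facO K t τ) L.scO L.wO Cw S.vol Λg (jlogOf L.Cl K) K) →
                1 ≤ Λg → L.θ' ≤ Λg →
                LedgerAtSync { L with S := Sz, E₀ := E₀, m := m, a := a, Cw := Cw, Λg := Λg } S.l₀ S.vol S.T S.Bad
                  (fun K t τ => S.A K t τ - S.shA K t τ) (fun K t τ => S.B K t τ - S.shB K t τ) Rd R.u3.EA EB R.u3.κ g uA uB
                  R.u3.ω R.u3.ρ R.u3.θ (θ ^ ((3 : ℝ) * β - 2))) ∧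
              0 ≤ S.vol ∧
              (∀ K t, |t| ≤ S.l₀ → ∀ τ ∈ S.T K \ S.Bad K t,
                WindowMultiplicity (L.facO K t τ) L.scO L.wO L.Cw S.vol L.Λg (jlogOf L.Cl K) K) ∧
              0 ≤ L.Cw ∧ 1 ≤ L.Λg ∧ L.θ' ≤ L.Λg ∧
              (∀ K, (Pf K).d = d₀) ∧ (∀ K, (Pf K).L = L₀) ∧ (∀ K, (Pf K).K = Koff + K) ∧
              (∀ K, (Fintype.card (Site (Pf K) (Pf K).K) : ℝ) = S.vol) ∧
              kappa₀ (4 * 2 ^ d₀) (2 * d₀) ≤ R.u3.κ ∧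
              (∀ K, ∀ X ∈ L.All K,
                (cells K (R.u3.C.scale X + Koff) X).Nonempty ∧ TFaceConnected (cells K (R.u3.C.scale X + Koff) X)) ∧
              (∀ K j, Set.InjOn (cells K j) ↑((L.All K).filter fun X => R.u3.C.scale X + Koff = j)) ∧
              (∀ K, ∀ X ∈ L.All K, torusTreeLen (cells K (R.u3.C.scale X + Koff) X) ≤ R.u3.C.d X) ∧
              0 < θ ∧ θ ^ 6 = ((R.ne3.L : ℝ))⁻¹ ∧
              (∀ v ∈ Rd.dom, rd v ∈ R.ne3.dom) ∧
              (∀ k, ∀ v ∈ Rd.dom, Rd.act k v = minAct 4 (sfClass 4 R.ne3.L R.ne3.Nper R.ne3.ε) R.ne3.L R.ne3.Nper k (rd v)) ∧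
              (R.ne3.Nper : ℝ) ^ 4 ≤ Rd.vol ∧
              (∀ s ∈ Window γ, 0 < bsel s ∧ bsel s ≤ γ)),
          SpineGivenEndpointR13SepCoPHV) := by
  obtain ⟨ℓ₃, g, B, c', ρ, c, hrows⟩ := exists_letters_awb16Rows_of_entry_reg910Slot (β := β) hβ1 hE hGm hG C hR
  refine ⟨ℓ₃, g, B, c', ρ, c, hrows, ?_⟩
  obtain ⟨hend, hmatch, -, hradii, hclass, h16, hloose, hρε, hρb, hc, -⟩ := hrows
  intro εTop hεT h8P hU6loc K₀ jc sh cr' l₀ Λ b aS ν μ α β' c35 p ℓ s r ksel hl₀ hΛ hb haS hs hκ hcr hκ₀ hr hinc hS h9 hWall hβw hζm h20 h21 hlinkBareV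
    h20' h21' hx' hlinkBare'
  exact spineGivenEndpointR13SepCoPHV_of_liveMintedV5PinsAtCrOfRecord₁₃VAt_cut_bareLedgerReadingV_n16Produced_offLive_mintedV5Pins_bareLedgerReading_n16Produced
    (K₀ := K₀) (jc := jc) (sh := sh) (cr' := cr') (β := β) (l₀ := l₀) (Λ := Λ) (b := b) (aS := aS) (ν := ν) (μ := μ) (α := α) (β' := β') (c35 := c35) (p := p)
    (ℓ := ℓ) (s := s) (r := r) (ℓ₃ := ℓ₃) (g := g) (B := B) (c' := c')
    ksel hl₀ hΛ hb haS h16 hs hκ hcr hκ₀ hr hinc hS h9 hWall hβ23 hβ1 hmatch hend hradii hclass ρ c εTop hloose hρε hεT h8P hU6loc hρb hc hβw hζm h20 h21 hlinkBareV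
    h20' h21' hx' hlinkBare'

end

end Summit.QuantumFields.YangMills.BalabanUVNodes.N16K3LeafOfEntryReg910Slot
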